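import Mathlib.Algebra.BigOperators.Intervals
import Mathlib.Algebra.Module.BigOperators
import Mathlib.Algebra.Order.Interval.Finset.Basic
import Mathlib.Data.Int.Interval
import Mathlib.Data.Real.Basic
import Mathlib.Tactic.Linarith
import Mathlib.Tactic.Ring

/-!
# The method-of-planes identity (finite window) — seed of slot 7b `GapStressVanishesW` (decomp-a2c lens-3, g26 line)

For layer pair data `f k l` (force per cell exerted across the pair of layers `k < l`) and gap heights `h m` (height of gap `m` = between layers
`m − 1` and `m`), the height-weighted pair sum over a finite window of layers `[K₀, K₁]` equals the gap sum of the TRANSMITTED loads: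

  `Σ_{K₀ ≤ k < l ≤ K₁} (Σ_{k < m ≤ l} h m) • f k l = Σ_{K₀ < m ≤ K₁} h m • Σ_{K₀ ≤ k < m ≤ l ≤ K₁} f k l`

(each pair `(k, l)` is counted once for every gap it straddles, weighted by that gap's height; `z_l − z_k = Σ_{k<m≤l} h m`).  With constant
transmitted load `σ` across every gap this is `(Σ h) • σ` up to window-boundary pairs — the mechanism by which the `(·, n)` column of the cube
virial of a layered configuration reads the gap stress (plan memo `PLAN-7b-GapStressVanishesW.md`).
-/

namespace Summit.AtomisticToContinuum.Crystallization.Theorems.ChartedPlanarOrderPlanesIdentity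

open Finset

variable {E : Type*} [AddCommMonoid E]

/-- indicator form of a sum over `Ioc k K₁` inside the window `Icc K₀ K₁` (`K₀ ≤ k`). -/
theorem sum_Ioc_eq_sum_Icc_ite {K₀ K₁ k : ℤ} (hk : K₀ ≤ k) (g : ℤ → E) :
    ∑ l ∈ Ioc k K₁, g l = ∑ l ∈ Icc K₀ K₁, if k < l then g l else 0 := by
  rw [← sum_filter]
  congr 1
  ext l
  simp only [mem_Ioc, mem_filter, mem_Icc]
  omega

/-- indicator form of a sum over `Ioc k l` inside the window (`K₀ ≤ k`, `l ≤ K₁`). -/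
theorem sum_Ioc_eq_sum_Icc_ite₂ {K₀ K₁ k l : ℤ} (hk : K₀ ≤ k) (hl : l ≤ K₁) (g : ℤ → E) :
    ∑ m ∈ Ioc k l, g m = ∑ m ∈ Icc K₀ K₁, if k < m ∧ m ≤ l then g m else 0 := by
  rw [← sum_filter]
  congr 1
  ext m
  simp only [mem_Ioc, mem_filter, mem_Icc]
  omega

/-- indicator form of the straddling double sum `Σ_{K₀ ≤ k < m} Σ_{m ≤ l ≤ K₁}` inside the window (`m ∈ [K₀, K₁]`). -/
theorem sum_straddle_eq_ite {K₀ K₁ m : ℤ} (hm₀ : K₀ ≤ m) (hm₁ : m ≤ K₁) (f : ℤ → ℤ → E) :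
    ∑ k ∈ Ico K₀ m, ∑ l ∈ Icc m K₁, f k l = ∑ k ∈ Icc K₀ K₁, ∑ l ∈ Icc K₀ K₁, if k < m ∧ m ≤ l then f k l else 0 := by
  have e1 : ∑ k ∈ Ico K₀ m, ∑ l ∈ Icc m K₁, f k l = ∑ k ∈ Icc K₀ K₁, if k < m then ∑ l ∈ Icc m K₁, f k l else 0 := by
    rw [← sum_filter]
    congr 1
    ext k
    simp only [mem_Ico, mem_filter, mem_Icc]
    omega
  rw [e1]
  refine sum_congr rfl fun k _ => ?_
  by_cases hkm : k < m
  · rw [if_pos hkm, ← sum_filter]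
    have e2 : (Icc K₀ K₁).filter (fun l => k < m ∧ m ≤ l) = Icc m K₁ := by
      ext l
      simp only [mem_filter, mem_Icc]
      omega
    rw [e2]
  · rw [if_neg hkm]
    symm
    exact sum_eq_zero fun l _ => by rw [if_neg (fun h => hkm h.1)]

variable [Module ℝ E]

/-- ★ **Method of planes, finite window.** -/
theorem sum_pairs_heights_smul (K₀ K₁ : ℤ) (h : ℤ → ℝ) (f : ℤ → ℤ → E) :
    ∑ k ∈ Icc K₀ K₁, ∑ l ∈ Ioc k K₁, (∑ m ∈ Ioc k l, h m) • f k l =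
      ∑ m ∈ Ioc K₀ K₁, h m • ∑ k ∈ Ico K₀ m, ∑ l ∈ Icc m K₁, f k l := by
  set I := Icc K₀ K₁ with hI
  -- left side as a triple indicator sum
  have L : ∑ k ∈ I, ∑ l ∈ Ioc k K₁, (∑ m ∈ Ioc k l, h m) • f k l =
      ∑ k ∈ I, ∑ l ∈ I, ∑ m ∈ I, if k < m ∧ m ≤ l then h m • f k l else 0 := by
    refine sum_congr rfl fun k hk => ?_
    rw [hI, mem_Icc] at hk
    rw [sum_Ioc_eq_sum_Icc_ite hk.1]
    refine sum_congr rfl fun l hl => ?_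
    rw [mem_Icc] at hl
    by_cases hkl : k < l
    · rw [if_pos hkl, sum_Ioc_eq_sum_Icc_ite₂ hk.1 hl.2, sum_smul]
      refine sum_congr rfl fun m _ => ?_
      split_ifs <;> simp
    · rw [if_neg hkl]
      symm
      exact sum_eq_zero fun m _ => by rw [if_neg (fun hm => hkl (lt_of_lt_of_le hm.1 hm.2))]
  -- right side as a triple indicator sum
  have R : ∑ m ∈ Ioc K₀ K₁, h m • ∑ k ∈ Ico K₀ m, ∑ l ∈ Icc m K₁, f k l =
      ∑ m ∈ I, ∑ k ∈ I, ∑ l ∈ I, if k < m ∧ m ≤ l then h m • f k l else 0 := by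
    have e0 : ∑ m ∈ Ioc K₀ K₁, h m • ∑ k ∈ Ico K₀ m, ∑ l ∈ Icc m K₁, f k l =
        ∑ m ∈ I, if K₀ < m then h m • ∑ k ∈ Ico K₀ m, ∑ l ∈ Icc m K₁, f k l else 0 := by
      rw [← sum_filter]
      congr 1
      ext m
      simp only [mem_Ioc, mem_filter, hI, mem_Icc]
      omega
    rw [e0]
    refine sum_congr rfl fun m hm => ?_
    rw [hI, mem_Icc] at hm
    by_cases hm₀ : K₀ < m
    · rw [if_pos hm₀, sum_straddle_eq_ite hm.1 hm.2, smul_sum]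
      refine sum_congr rfl fun k _ => ?_
      rw [smul_sum]
      refine sum_congr rfl fun l _ => ?_
      split_ifs <;> simp
    · rw [if_neg hm₀]
      symm
      exact sum_eq_zero fun k hk => sum_eq_zero fun l _ => by
        rw [hI, mem_Icc] at hk
        rw [if_neg (fun hkm => hm₀ (lt_of_le_of_lt hk.1 hkm.1))]
  rw [L, R]
  exact (sum_congr rfl fun k _ => sum_comm).trans sum_comm

/-- ★ **Constant transmitted load.**  If across every gap `m` of the window the straddling pairs INSIDE the window carry total load `σ m`,
the height-weighted pair sum is `Σ h m • σ m`; with `σ m = σ` constant it is `(Σ h) • σ`. -/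
theorem sum_pairs_heights_smul_const (K₀ K₁ : ℤ) (h : ℤ → ℝ) (f : ℤ → ℤ → E) (σ : E)
    (hσ : ∀ m ∈ Ioc K₀ K₁, ∑ k ∈ Ico K₀ m, ∑ l ∈ Icc m K₁, f k l = σ) :
    ∑ k ∈ Icc K₀ K₁, ∑ l ∈ Ioc k K₁, (∑ m ∈ Ioc k l, h m) • f k l = (∑ m ∈ Ioc K₀ K₁, h m) • σ := by
  rw [sum_pairs_heights_smul, sum_smul]
  exact sum_congr rfl fun m hm => by rw [hσ m hm]

/-- ★ weighted form (layer weights `N k`, e.g. the number of atoms of layer `k` inside a cube): the same identity for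
`f' k l := (N k + N l) • f k l`. -/
theorem sum_pairs_heights_weights (K₀ K₁ : ℤ) (h N : ℤ → ℝ) (f : ℤ → ℤ → E) :
    ∑ k ∈ Icc K₀ K₁, ∑ l ∈ Ioc k K₁, ((N k + N l) * ∑ m ∈ Ioc k l, h m) • f k l =
      ∑ m ∈ Ioc K₀ K₁, h m • ∑ k ∈ Ico K₀ m, ∑ l ∈ Icc m K₁, (N k + N l) • f k l := by
  rw [← sum_pairs_heights_smul K₀ K₁ h (fun k l => (N k + N l) • f k l)]
  refine sum_congr rfl fun k _ => sum_congr rfl fun l _ => ?_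
  rw [mul_comm, mul_smul]

/-- telescoping bound: `|N p − N q| ≤ Σ_{j ∈ Ico q p} |N (j+1) − N j|` for `q ≤ p`. -/
theorem abs_sub_le_sum_Ico (N : ℤ → ℝ) {q p : ℤ} (hqp : q ≤ p) :
    |N p - N q| ≤ ∑ j ∈ Ico q p, |N (j + 1) - N j| := by
  obtain ⟨n, rfl⟩ : ∃ n : ℕ, p = q + n := ⟨(p - q).toNat, by rw [Int.toNat_of_nonneg (sub_nonneg.mpr hqp)]; ring⟩
  clear hqp
  induction n with
  | zero => simp
  | succ n ih =>
    have hsplit : Ico q (q + ((n + 1 : ℕ) : ℤ)) = insert (q + n) (Ico q (q + n)) := by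
      ext j
      simp only [mem_Ico, mem_insert, Nat.cast_succ]
      omega
    have hnot : (q + n : ℤ) ∉ Ico q (q + n) := by simp
    rw [hsplit, sum_insert hnot]
    have e : N (q + ((n + 1 : ℕ) : ℤ)) - N q = (N (q + n + 1) - N (q + n)) + (N (q + n) - N q) := by
      push_cast
      ring
    rw [e]
    exact (abs_add_le _ _).trans (by linarith)

/-- ★ the weight-replacement error, termwise: for `k < m ≤ l`,
`|(N k + N l) − (N (m−1) + N m)| ≤ 2 Σ_{j ∈ Ico k l} |N (j+1) − N j|` (both corrections telescope inside `[k, l)`). -/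
theorem abs_weights_sub_le (N : ℤ → ℝ) {k m l : ℤ} (hkm : k < m) (hml : m ≤ l) :
    |(N k + N l) - (N (m - 1) + N m)| ≤ 2 * ∑ j ∈ Ico k l, |N (j + 1) - N j| := by
  have h1 : |N (m - 1) - N k| ≤ ∑ j ∈ Ico k l, |N (j + 1) - N j| :=
    (abs_sub_le_sum_Ico N (by omega : k ≤ m - 1)).trans
      (sum_le_sum_of_subset_of_nonneg (Ico_subset_Ico le_rfl (by omega)) fun _ _ _ => abs_nonneg _)
  have h2 : |N l - N m| ≤ ∑ j ∈ Ico k l, |N (j + 1) - N j| :=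
    (abs_sub_le_sum_Ico N hml).trans
      (sum_le_sum_of_subset_of_nonneg (Ico_subset_Ico (by omega) le_rfl) fun _ _ _ => abs_nonneg _)
  have e : (N k + N l) - (N (m - 1) + N m) = (N l - N m) - (N (m - 1) - N k) := by ring
  rw [e]
  exact (abs_sub _ _).trans (by linarith)

end Summit.AtomisticToContinuum.Crystallization.Theorems.ChartedPlanarOrderPlanesIdentity
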